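import Literature.MathematicalPhysics.QuantumFieldTheory.Balaban1983to89.B9Eq343HolderDelta2ZdFinite
import Literature.MathematicalPhysics.QuantumFieldTheory.Balaban1983to89.B9SupplySockB9P3ZdFrameXi
import Literature.MathematicalPhysics.QuantumFieldTheory.Balaban1983to89.B9Lemma21RowLetterZd

/-!
# `Balaban1983to89.B9Eq343HolderXiZdFinite` — [Balaban1985RegularSpaces] (1.36) p. 82 ∕ (1.59) p. 86 ∕ Prop. 3 p. 87, [Balaban1985BackgroundPropagators] Thm 3.3
# (3.42)+(3.43) pp. 397–399 WITH PRINT'S ξ-SCALED CUT-OFF NORM, [Balaban1984PropagatorsII] Lemma 2.1 p. 234: dag-n06-b's Hölder binder `HolderAtδ2` at the Ξ edition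
# of the `ℤᵈ` frame is a theorem on every finite member with a MEMBER-UNIFORM constant `max((4^β+1)L³K, 2·4^β L³K)`, `K = K261(N₀, d, L, 1, δ₀ − κ₂)` — the cut-off
# factor of every block is `≤ 4^β + 1`, so ONE cube-exchange letter `(L^{j_u}η)³ ≤ L³e^{κ₂d(u,v)}(L^{j_v}η)³` ((2.60)) and the row sum (2.61) serve both the near pairs
# ((3.43)) and the far pairs ((3.42))

statement-level skeleton of published theorems with citation tags; proofs where landed; nothing here is a claim about the
Yang–Mills mass gap

PDF held: `paper:balaban1985-cmp99-background-propagators` pp. 397–398 ((3.40), (3.42), (3.43) «(‖ζ‖^ξ_β + |ζ|), ξ = L^{−j}»); `paper:balaban1985-cmp99-regular-spaces-gauge-fixing`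
pp. 82, 86–87; [Balaban1984PropagatorsII] Lemma 2.1 p. 234 — through the audited headers of dag-n06-w2 g2's `B9Eq343HolderDelta2ZdFinite` (whose §1–§4 this file re-runs),
`B9Eq343HolderGlobalFromLocalZd`, `B9Eq343CutoffFamilyZd`, `B9Eq347GlobalFromLocalZdFinite`, and this seat's `B9SupplySockB9P3ZdFrameXi` (the Ξ frame) — BY NAME.

WHY THIS FILE (cell `pub-ymgap`, HUMAN RULING D-0062 ∕ D-0149; seat `pub-ymgap-dag-n06-w2` (g3), node N06 = [B9]; CLAIM-4, file X2; count-neutral).  g2 discharged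
`HolderAtδ2` at `geoZd` with the constant `max (R_H·|𝔅|) (2·4^β·R₁·|𝔅|)`, `R_H = (max_u (L^{j_u}η)^{2+β}·(L^{j_u}η)^{1−β}·cutHZd(ζ_u))·(max_v (L^{j_v}η)^{−3})` — DIVERGENT as
`η → 0` because the `η`-scaled norm of the canonical cut-off is `≥ ((⌊Lʲ∕4⌋+1)η)^{−β}` (located (L-H2)).  At the Ξ frame the (3.43) reading carries print's
`‖ζ‖^ξ_β + |ζ| ≤ 4^β + 1` (`cutHXi_zetaZd_le`), the block factor becomes `(4^β + 1)·(L^{j_u}η)^{1−β}`, and `(L^{j_u}η)^{2+β}·(L^{j_u}η)^{1−β} = (L^{j_u}η)³`: the SAME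
letter `(L^{j_u}η)³ ≤ R·e^{κ₂d(u,v)}·(L^{j_v}η)³` that feeds the far pairs feeds the near pairs, and the constant is `η`-free.

WHAT IS PROVED (0 sorry; proof lane — no `def`).
* §1 `blockFactorXi_nonneg` · `blockFactorXi_zetaZd_le` · ★ `locHolder_grad_of_ineq343Xi` (the (3.43) clause at Ξ as a pointwise local Hölder letter with block factor
  `(L^{j_u}η)^{1−β}·(‖ζ_u‖^ξ_β + |ζ_u|)`) · `weight_mul_hquot_gradGop_le_of_ineq343Xi` (g2's touch-assigned near-pair summation at Ξ, ANY cut-off family).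
* §2 ★★ `weight_mul_hquot_gradGop_le_bothXi` (pointwise both-points bound from ONE exchange letter `hex3`) · ★★ `holderBoth_msup_le_CHXi` (msup form: `≤ max ((4^β+1)RS)
  (2·4^β RS)·(B₀ + max 0 (Bβ β))·M`).
* §3 ★★ `msup_holder_le_of_letters` (THE CORE over abstract Lemma-2.1 letters `hex3` (2.60)-shape ∕ `hS` (2.61)-shape: the weighted Hölder supremum of `∇_{U₀}G(U₀)J`
  over pairs with both points in `Ω_j` is `≤ max((4^β+1)RS, 2·4^β RS)·(B₀ + max 0 (Bβ β))·|J|₍₋₃₎`) · ★★★ `holderAtδ2_zdXi_of_finite` — `HolderAtδ2 (geoZdXi …) (bgZd …)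
  (GAZdXiFamOfOps … ops) L memZd (ιCfgZd …) ops β len CH M i m` on every finite member (g2's `holderAtδ2_zd_of_finite` hypotheses) with the member's letters at `κ₂ := 0`,
  `CH := fun _ => max ((4^β+1)·E₃·|𝔅|) (2·4^β·E₃·|𝔅|)`, `E₃ = (max_u (L^{j_u}η)³)(max_v (L^{j_v}η)^{−3}) = L^{3(j_max−j_min)}` — `η`-FREE · ★★★★ `holderAtδ2_zdXi_uniform` — the
  SAME binder with print's MEMBER-UNIFORM constant `CH δ₀ = max ((4^β+1)·L³·K) (2·4^β·L³·K)`, `K = K261 N₀ d L 1 (δ₀ − κ₂)` (a function of `(d, L, β, N₀, κ₂, δ₀)` only) in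
  the summable regime `e^{−(δ₀−κ₂)}L^{2d∕N₀} < 1` (else the finite-member constant), on members with connected block graph (`Ω₀` a box or `ℤᵈ`: `B9GraphZdConnected`),
  `Sep22Zd R`, `N₀ ≤ R⌈M⌉`, `3 log L ≤ κ₂R⌈M⌉` — g2's `cube_exchange_of_connected` ((2.60)) + `rowLetter261_hS` ((2.61)) BY NAME.
HONEST SCOPE.  Summation bookkeeping over landed estimates at a re-typed slot; nothing of [4] Thm 3.1∕3.3 asserted (`h342`, `h345` AT Ξ are the binder's own inputs — the
(3.43) reading with print's norm is STRONGER than the tree's η-scaled one and is what Thm 3.3 must supply); count-neutral; N05∕N06 NOT discharged; one finite lattice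
programme at fixed `ε`; R4 closes the conditional finite-𝕋⁴ rung `BalabanLadder.UV` only; nothing continuum ∕ ℝ⁴ ∕ OS ∕ mass-gap ∕ Clay.  Unit `pub-ymgap-dag-n06-w2` (g3), 2026-08-28.
-/

noncomputable section

namespace Literature.MathematicalPhysics.QuantumFieldTheory.Balaban1983to89.B9Eq343HolderXiZdFinite

open B7Prop1Local (InBox)
open B7Prop1Explicit (e)
open B7Prop2Explicit (unitaryUnits)
open B8Ineq132 (covDerivFwd BondTouches)
open B8ScaledSupNorm (msup weight Bdd weight_mul_norm_le_msup bondNorm)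
open B8LeafModelZd (ZdIdx)
open B9Eq340HolderZd (hquot AdmPair hquot_nonneg)
open B9SupplySockB9P3ZdLetters (OpsZd)
open B9SupplySockB9P3ZdLettersOmega (restrictDom)
open B9SupplySockB9P3ZdFrame (MemberZd memZd BSite blockZd blockTZd CfgZd bgZd ιCfgZd distZd supNormZd graphZd Sep22Zd)
open B9SupplySockB9P3ZdLocalLettersOfOps (cdBZd cutMulZd supBlkZd eOfOps)
open B9SupplySockB9P3ZdFrameXi (cutHXi cutHXi_nonneg cutHXi_zetaZd_le geoZdXi GAZdXiOfOps GAZdXiFamOfOps ineq342Zd_of_ineq342Xi ineq343_h1_of_GAZdXiOfOps)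
open B9Eq347GlobalFromLocalZd (extZd comp_linear cdBZd_linear)
open B9Lemma21ShellCrossingZd (Omega_antitone cube_exchange_of_connected)
open B9Lemma21RowLetterZd (rowLetter261_hS)
open B6Ineq261LevelGap (K261 K261_nonneg)
open B9Eq347GlobalFromLocalZdFinite (exchangeLetter_of_fintype rowLetter_of_fintype exchangeConst_nonneg)
open B9Eq343HolderGlobalFromLocalZd (hquot_cutMulZd_of_eq_one hquot_cut_grad_le_h1OfOps finite_support_of_cutInT weight_mul_hquot_le_of_far)
open B9Eq343CutoffFamilyZd (zetaZd coreZd zetaZd_eq_one_of_mem_blockZd zetaZd_eq_one_of_mem_coreZd mem_blockTZd_of_zetaZd_ne_zero)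
open B9Eq343HolderBothZdFinite (scale_mono weight_holder_le weight_two_le quarter_scale_le_len)
open B9Eq343HolderDelta2ZdFinite (weight_mul_hquot_cut_le_of_local' weight_mul_norm_gradGop_le_of_ineq342' restrictDom_eq_extZd bdd_neg_three_of_finite
  B0_nonneg_of_ineq342_zd)
open B9SupplySockB9P3ZdGammaUnivDelta2 (HolderAtδ2)
open LatticeNorms (linfDist)

-- `Site` alone could resolve to the torus sites of `Setup.lean`; re-export the `ℤ^d` sites of `B7Prop1Explicit`.
export B7Prop1Explicit (Site)

variable {d : ℕ}

/-! ## §1 The (3.43) clause at Ξ as a local Hölder letter; the near-pair summation -/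

section Local

variable {𝔸 : Type} [CStarAlgebra 𝔸] {L : ℕ} {len : Site d → ℝ}

/-- the Ξ block factor `(L^{j_u}η)^{1−β}·(‖ζ_u‖^ξ_β + |ζ_u|)` is non-negative. [cite: Balaban1985BackgroundPropagators, (3.43) p.398 (bookkeeping)] -/
theorem blockFactorXi_nonneg (x : MemberZd d L) (β : ℝ) (ζ : BSite L x → Site d → ℝ) (u : BSite L x) :
    0 ≤ ((L : ℝ) ^ u.1.1 * x.i.η) ^ (1 - β) * cutHXi L x.i.η β len u.1.1 (ζ u) :=
  mul_nonneg (Real.rpow_nonneg (by have := x.i.hη.le; positivity) _) (cutHXi_nonneg L x.i.hη.le β len u.1.1 (ζ u))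

/-- **THE Ξ BLOCK FACTOR OF THE CANONICAL CUT-OFF IS `≤ (4^β + 1)·(L^{j_u}η)^{1−β}`** — uniformly in the member (`0 ≤ β ≤ 1`, `len` dominating the sup-distance).
[cite: Balaban1985BackgroundPropagators, (3.43) p.398] -/
theorem blockFactorXi_zetaZd_le (x : MemberZd d L) {β : ℝ} (hβ0 : 0 ≤ β) (hβ1 : β ≤ 1)
    (hlen : ∀ z z' : Site d, (linfDist z z' : ℝ) ≤ len (z' - z)) (u : BSite L x) :
    ((L : ℝ) ^ u.1.1 * x.i.η) ^ (1 - β) * cutHXi L x.i.η β len u.1.1 (zetaZd L u.1.1 u.1.2) ≤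
      ((4 : ℝ) ^ β + 1) * ((L : ℝ) ^ u.1.1 * x.i.η) ^ (1 - β) := by
  rw [mul_comm (((4 : ℝ) ^ β + 1))]
  exact mul_le_mul_of_nonneg_left (cutHXi_zetaZd_le L u.1.1 u.1.2 x.i.hη hβ0 hβ1 hlen) (Real.rpow_nonneg (by have := x.i.hη.le; positivity) _)

variable [Nontrivial 𝔸]

/-- ★ **THE (3.43) CLAUSE AT Ξ READ AS A POINTWISE LOCAL HÖLDER LETTER FOR `∇_{U,ν}∘G(U)`**: for a cut-off FAMILY `ζ_u` supported in `Δ̃(u)` and `J` supported on the bonds of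
`Δ(v)`, every quotient of `ζ_u·∇_{U,ν}G(U)J` is `≤ max{0, Bβ β}·(L^{j_u}η)^{1−β}·(‖ζ_u‖^ξ_β + |ζ_u|)·e^{−δ₀d(u,v)}·|J|` (g2's `locHolder_grad_of_ineq343` at the Ξ reading).
[cite: Balaban1985BackgroundPropagators, (3.43) p.398, Thm 3.3 p.399] -/
theorem locHolder_grad_of_ineq343Xi {x : MemberZd d L} {ops : OpsZd d 𝔸} {U : CfgZd d 𝔸} {Bβ Bε : ℝ → ℝ} {Bεβ : ℝ → ℝ → ℝ}
    {δ₀ β : ℝ} (h345 : B9.Ineq343_345 (GAZdXiOfOps 𝔸 L len x ops) Bβ Bε Bεβ δ₀ U) (hβ0 : 0 ≤ β) (hβ1 : β < 1)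
    (hlen : ∀ v : Site d, 0 < len v → 1 ≤ len v) (ζ : BSite L x → Site d → ℝ)
    (hζ : ∀ (u : BSite L x) (z : Site d), ζ u z ≠ 0 → z ∈ blockTZd L u.1.1 u.1.2) (ν : Fin d)
    (u v : BSite L x) (J : Site d → Fin d → 𝔸) (hJ : ∀ (z : Site d) (μ : Fin d), J z μ ≠ 0 → BondTouches (blockZd L v.1.1 v.1.2) z μ)
    (μ : Fin d) (p : Site d × Site d) (hp : p ∈ AdmPair x.i.η len) :
    hquot x.i.η β len U.1 (fun z => cutMulZd (ζ u) (cdBZd x.i.η U.1 ν (ops.Gop U.1 J)) z μ) p ≤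
      max 0 (Bβ β) * (((L : ℝ) ^ u.1.1 * x.i.η) ^ (1 - β) * cutHXi L x.i.η β len u.1.1 (ζ u)) *
        Real.exp (-(δ₀ * distZd L x u v)) * supNormZd J := by
  have h1 := hquot_cut_grad_le_h1OfOps ops U J hβ0 hlen (finite_support_of_cutInT (hζ u)) ν μ hp
  have h2 := ineq343_h1_of_GAZdXiOfOps (𝔸 := 𝔸) (L := L) (len := len) h345 β J (ζ u) u v hβ0 hβ1 (hζ u) hJ
  have hs : 0 ≤ ((L : ℝ) ^ u.1.1 * x.i.η) ^ (1 - β) := Real.rpow_nonneg (by have := x.i.hη.le; positivity) _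
  have hc : 0 ≤ cutHXi L x.i.η β len u.1.1 (ζ u) := cutHXi_nonneg L x.i.hη.le β len u.1.1 (ζ u)
  have hn : 0 ≤ supNormZd J := Real.iSup_nonneg fun _ => norm_nonneg _
  have h3 : Bβ β * ((L : ℝ) ^ u.1.1 * x.i.η) ^ (1 - β) * cutHXi L x.i.η β len u.1.1 (ζ u) * Real.exp (-(δ₀ * distZd L x u v)) * supNormZd J ≤
      max 0 (Bβ β) * (((L : ℝ) ^ u.1.1 * x.i.η) ^ (1 - β) * cutHXi L x.i.η β len u.1.1 (ζ u)) * Real.exp (-(δ₀ * distZd L x u v)) * supNormZd J := by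
    have := mul_le_mul_of_nonneg_right (le_max_right 0 (Bβ β))
      (mul_nonneg (mul_nonneg (mul_nonneg hs hc) (Real.exp_nonneg (-(δ₀ * distZd L x u v)))) hn)
    calc _ = Bβ β * (((L : ℝ) ^ u.1.1 * x.i.η) ^ (1 - β) * cutHXi L x.i.η β len u.1.1 (ζ u) * Real.exp (-(δ₀ * distZd L x u v)) * supNormZd J) := by
          ring
      _ ≤ max 0 (Bβ β) * (((L : ℝ) ^ u.1.1 * x.i.η) ^ (1 - β) * cutHXi L x.i.η β len u.1.1 (ζ u) * Real.exp (-(δ₀ * distZd L x u v)) *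
          supNormZd J) := this
      _ = _ := by ring
  exact h1.trans (h2.trans h3)

/-- **THE NEAR-PAIR BOUND AT Ξ, TOUCH-ASSIGNED SOURCES**: (3.43) at the Ξ readings summed (g2's `weight_mul_hquot_cut_le_of_local'` with the Ξ block factor), cut-off `1` at both
points. [cite: Balaban1985BackgroundPropagators, (3.43) p.398, (3.40) p.397, Thm 3.3 p.399; Balaban1985RegularSpaces, Prop. 3 p.87, (1.36) p.82; Balaban1984PropagatorsII, Lemma 2.1 p.234] -/
theorem weight_mul_hquot_gradGop_le_of_ineq343Xi {x : MemberZd d L} [Fintype (BSite L x)] {ops : OpsZd d 𝔸} {U : CfgZd d 𝔸}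
    {Bβ Bε : ℝ → ℝ} {Bεβ : ℝ → ℝ → ℝ} {δ₀ β : ℝ} (h345 : B9.Ineq343_345 (GAZdXiOfOps 𝔸 L len x ops) Bβ Bε Bεβ δ₀ U)
    (hβ0 : 0 ≤ β) (hβ1 : β < 1) (hlen : ∀ v : Site d, 0 < len v → 1 ≤ len v)
    (hlin : ∀ (c : ℝ) (A B : Site d → Fin d → 𝔸), ops.Gop U.1 (c • A + B) = c • ops.Gop U.1 A + ops.Gop U.1 B)
    (ζ : BSite L x → Site d → ℝ) (hζ : ∀ (u : BSite L x) (z : Site d), ζ u z ≠ 0 → z ∈ blockTZd L u.1.1 u.1.2)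
    {P : Site d × Fin d → Prop} (π : {b : Site d × Fin d // P b} → BSite L x)
    (hπ' : ∀ b, BondTouches (blockZd L (π b).1.1 (π b).1.2) b.1.1 b.1.2)
    {κ₂ R S : ℝ} (hR : 0 ≤ R) {ω ω' : BSite L x → ℝ} (hω : ∀ v, 0 < ω v) (hω' : ∀ u, 0 ≤ ω' u)
    (hex : ∀ u v : BSite L x,
      ω' u * (((L : ℝ) ^ u.1.1 * x.i.η) ^ (1 - β) * cutHXi L x.i.η β len u.1.1 (ζ u)) ≤ R * Real.exp (κ₂ * distZd L x u v) * ω v)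
    (hS : ∀ u : BSite L x, ∑ v, Real.exp (-((δ₀ - κ₂) * distZd L x u v)) ≤ S)
    (ν : Fin d) (f : {b : Site d × Fin d // P b} → 𝔸) {M : ℝ} (hM : 0 ≤ M) (hMf : ∀ y, ω (π y) * ‖f y‖ ≤ M)
    (u : BSite L x) (μ : Fin d) {p : Site d × Site d} (hp : p ∈ AdmPair x.i.η len) (h1 : ζ u p.1 = 1) (h2 : ζ u p.2 = 1) :
    ω' u * hquot x.i.η β len U.1 (covDerivFwd x.i.η U.1 ν (fun z => ops.Gop U.1 (extZd P f) z μ)) p ≤ max 0 (Bβ β) * R * S * M := by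
  have h := weight_mul_hquot_cut_le_of_local' U β (fun J => cdBZd x.i.η U.1 ν (ops.Gop U.1 J)) (comp_linear (cdBZd_linear x.i.η U.1 ν) hlin) ζ
    (le_max_left 0 (Bβ β)) (blockFactorXi_nonneg (len := len) x β ζ)
    (fun u' v J hJ μ' p' hp' => locHolder_grad_of_ineq343Xi h345 hβ0 hβ1 hlen ζ hζ ν u' v J hJ μ' p' hp')
    π hπ' hR hω hω' hex hS f hM hMf u μ hp
  rw [hquot_cutMulZd_of_eq_one U.1 (ζ u) _ μ h1 h2] at h
  exact h

end Local

/-! ## §2 The both-points bound at Ξ from ONE cube-exchange letter -/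

section Both

variable {𝔸 : Type} [CStarAlgebra 𝔸] [Nontrivial 𝔸] {L : ℕ} {len : Site d → ℝ}

-- budget line: two long instantiations + case split (g2's §2 shape); margin for Mathlib drift
set_option maxHeartbeats 400000 in
/-- ★★ **THE REPAIRED HÖLDER LINE AT Ξ, POINTWISE** — g2's `weight_mul_hquot_gradGop_le_both'` with print's cut-off norm: ONE exchange letter
`hex3 : (L^{j_u}η)³ ≤ R·e^{κ₂d(u,v)}·ω(v)` serves the near pairs (block factor `≤ (4^β+1)(L^{j_u}η)^{1−β}`, weight `(L^{j_u}η)^{2+β}`, product `(4^β+1)(L^{j_u}η)³`) AND the far pairs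
(the n = 1 sup entry, weight `(L^{j_u}η)²`, local factor `L^{j_u}η`). [cite: Balaban1985RegularSpaces, (1.36) p.82, (1.59) p.86, Prop. 3 p.87; Balaban1985BackgroundPropagators, (3.42) p.397, (3.43) p.398, Thm 3.3 p.399; Balaban1984PropagatorsII, Lemma 2.1 (2.60)–(2.61) p.234] -/
theorem weight_mul_hquot_gradGop_le_bothXi {x : MemberZd d L} [Fintype (BSite L x)] (hL : 1 ≤ L) {ops : OpsZd d 𝔸} {U : CfgZd d 𝔸}
    {B₀ δ₀ β : ℝ} {Bβ Bε : ℝ → ℝ} {Bεβ : ℝ → ℝ → ℝ} (hB₀ : 0 ≤ B₀)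
    (h342 : B9.Ineq342_346_347 (GAZdXiOfOps 𝔸 L len x ops) B₀ δ₀ U) (h345 : B9.Ineq343_345 (GAZdXiOfOps 𝔸 L len x ops) Bβ Bε Bεβ δ₀ U)
    (hβ0 : 0 ≤ β) (hβ1 : β < 1) (hlen1 : ∀ v : Site d, 0 < len v → 1 ≤ len v)
    (hlen : ∀ z z' : Site d, (linfDist z z' : ℝ) ≤ len (z' - z))
    (hlin : ∀ (c : ℝ) (A B : Site d → Fin d → 𝔸), ops.Gop U.1 (c • A + B) = c • ops.Gop U.1 A + ops.Gop U.1 B)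
    {P : Site d × Fin d → Prop} (π : {b : Site d × Fin d // P b} → BSite L x)
    (hπ' : ∀ b, BondTouches (blockZd L (π b).1.1 (π b).1.2) b.1.1 b.1.2)
    (hπbase : ∀ (b : {b : Site d × Fin d // P b}) (j : ℕ), j ≤ x.m → b.1.1 ∈ x.i.Ω j → b.1.1 ∈ blockZd L (π b).1.1 (π b).1.2)
    (hPΩ : ∀ j, j ≤ x.m → ∀ (z : Site d) (μ : Fin d), z ∈ x.i.Ω j → P (z, μ))
    (hlev : ∀ (b : {b : Site d × Fin d // P b}) (j : ℕ), j ≤ x.m → b.1.1 ∈ x.i.Ω j → j ≤ (π b).1.1)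
    {κ₂ R S : ℝ} (hR : 0 ≤ R) {ω : BSite L x → ℝ} (hω : ∀ v, 0 < ω v)
    (hex3 : ∀ u v : BSite L x, ((L : ℝ) ^ u.1.1 * x.i.η) ^ 3 ≤ R * Real.exp (κ₂ * distZd L x u v) * ω v)
    (hS : ∀ u : BSite L x, ∑ v, Real.exp (-((δ₀ - κ₂) * distZd L x u v)) ≤ S)
    (ν : Fin d) (f : {b : Site d × Fin d // P b} → 𝔸) {M : ℝ} (hM : 0 ≤ M) (hMf : ∀ y, ω (π y) * ‖f y‖ ≤ M)
    {j : ℕ} (hj : j ≤ x.m) (μ : Fin d) {p : Site d × Site d} (hp : p ∈ AdmPair x.i.η len) (hxΩ : p.1 ∈ x.i.Ω j) (hx'Ω : p.2 ∈ x.i.Ω j) :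
    weight L x.i.η (-(2 + β)) j * hquot x.i.η β len U.1 (covDerivFwd x.i.η U.1 ν (fun z => ops.Gop U.1 (extZd P f) z μ)) p ≤
      (max 0 (Bβ β) * (((4 : ℝ) ^ β + 1) * R) * S + 2 * (4 : ℝ) ^ β * (B₀ * R * S)) * M := by
  have hη : 0 < x.i.η := x.i.hη
  have h342' := ineq342Zd_of_ineq342Xi (𝔸 := 𝔸) (L := L) (len := len) h342
  have h4β : 0 ≤ (4 : ℝ) ^ β := Real.rpow_nonneg (by norm_num) β
  have hS0 : 0 ≤ S := by
    obtain ⟨hp', _⟩ := And.intro hp hxΩ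
    exact (Finset.sum_nonneg fun v _ => Real.exp_nonneg _).trans (hS (π ⟨(p.1, μ), hPΩ j hj p.1 μ hxΩ⟩))
  -- the exchange letters g2's summations consume, both from `hex3`
  have hexH : ∀ u v : BSite L x, ((L : ℝ) ^ u.1.1 * x.i.η) ^ (2 + β) *
      (((L : ℝ) ^ u.1.1 * x.i.η) ^ (1 - β) * cutHXi L x.i.η β len u.1.1 (zetaZd L u.1.1 u.1.2)) ≤
        (((4 : ℝ) ^ β + 1) * R) * Real.exp (κ₂ * distZd L x u v) * ω v := by
    intro u v
    have ht : 0 < (L : ℝ) ^ u.1.1 * x.i.η := B8ScaledSupNorm.scale_pos hL hη u.1.1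
    have hw : 0 ≤ ((L : ℝ) ^ u.1.1 * x.i.η) ^ (2 + β) := Real.rpow_nonneg ht.le _
    have hcube : ((L : ℝ) ^ u.1.1 * x.i.η) ^ (2 + β) * ((L : ℝ) ^ u.1.1 * x.i.η) ^ (1 - β) = ((L : ℝ) ^ u.1.1 * x.i.η) ^ 3 := by
      rw [← Real.rpow_add ht]
      norm_num
    calc ((L : ℝ) ^ u.1.1 * x.i.η) ^ (2 + β) * (((L : ℝ) ^ u.1.1 * x.i.η) ^ (1 - β) * cutHXi L x.i.η β len u.1.1 (zetaZd L u.1.1 u.1.2))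
        ≤ ((L : ℝ) ^ u.1.1 * x.i.η) ^ (2 + β) * ((((4 : ℝ) ^ β + 1)) * ((L : ℝ) ^ u.1.1 * x.i.η) ^ (1 - β)) :=
          mul_le_mul_of_nonneg_left (blockFactorXi_zetaZd_le (len := len) x hβ0 hβ1.le hlen u) hw
      _ = ((4 : ℝ) ^ β + 1) * ((L : ℝ) ^ u.1.1 * x.i.η) ^ 3 := by rw [← hcube]; ring
      _ ≤ ((4 : ℝ) ^ β + 1) * (R * Real.exp (κ₂ * distZd L x u v) * ω v) := mul_le_mul_of_nonneg_left (hex3 u v) (by positivity)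
      _ = (((4 : ℝ) ^ β + 1) * R) * Real.exp (κ₂ * distZd L x u v) * ω v := by ring
  have hex1 : ∀ u v : BSite L x, ((L : ℝ) ^ u.1.1 * x.i.η) ^ 2 * ((L : ℝ) ^ u.1.1 * x.i.η) ≤ R * Real.exp (κ₂ * distZd L x u v) * ω v := by
    intro u v
    have : ((L : ℝ) ^ u.1.1 * x.i.η) ^ 2 * ((L : ℝ) ^ u.1.1 * x.i.η) = ((L : ℝ) ^ u.1.1 * x.i.η) ^ 3 := by ring
    rw [this]
    exact hex3 u v
  have hR' : 0 ≤ ((4 : ℝ) ^ β + 1) * R := by positivity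
  set b : {b : Site d × Fin d // P b} := ⟨(p.1, μ), hPΩ j hj p.1 μ hxΩ⟩ with hb
  have hju : j ≤ (π b).1.1 := hlev b j hj hxΩ
  have hxblk : p.1 ∈ blockZd L (π b).1.1 (π b).1.2 := hπbase b j hj hxΩ
  have hq0 : 0 ≤ hquot x.i.η β len U.1 (covDerivFwd x.i.η U.1 ν (fun z => ops.Gop U.1 (extZd P f) z μ)) p := hquot_nonneg hη.le β U.1 _ hp
  have hnear0 : 0 ≤ max 0 (Bβ β) * (((4 : ℝ) ^ β + 1) * R) * S * M := by positivity
  have hfar0 : 0 ≤ 2 * (4 : ℝ) ^ β * (B₀ * R * S) * M := by positivity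
  by_cases hcore : p.2 ∈ coreZd L (π b).1.1 (π b).1.2
  · have h1 : zetaZd L (π b).1.1 (π b).1.2 p.1 = 1 := zetaZd_eq_one_of_mem_blockZd hxblk
    have h2 : zetaZd L (π b).1.1 (π b).1.2 p.2 = 1 := zetaZd_eq_one_of_mem_coreZd hcore
    have hnear := weight_mul_hquot_gradGop_le_of_ineq343Xi (len := len) h345 hβ0 hβ1 hlen1 hlin (fun u => zetaZd L u.1.1 u.1.2)
      (fun u z hz => mem_blockTZd_of_zetaZd_ne_zero hz) π hπ' hR' hω
      (fun u => Real.rpow_nonneg (B8ScaledSupNorm.scale_pos hL hη u.1.1).le _) hexH hS ν f hM hMf (π b) μ hp h1 h2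
    have hw : weight L x.i.η (-(2 + β)) j ≤ ((L : ℝ) ^ (π b).1.1 * x.i.η) ^ (2 + β) := weight_holder_le hL hη hβ0 hju
    calc weight L x.i.η (-(2 + β)) j * hquot x.i.η β len U.1 (covDerivFwd x.i.η U.1 ν (fun z => ops.Gop U.1 (extZd P f) z μ)) p
        ≤ ((L : ℝ) ^ (π b).1.1 * x.i.η) ^ (2 + β) * hquot x.i.η β len U.1 (covDerivFwd x.i.η U.1 ν (fun z => ops.Gop U.1 (extZd P f) z μ)) p :=
          mul_le_mul_of_nonneg_right hw hq0
      _ ≤ max 0 (Bβ β) * (((4 : ℝ) ^ β + 1) * R) * S * M := hnear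
      _ ≤ (max 0 (Bβ β) * (((4 : ℝ) ^ β + 1) * R) * S + 2 * (4 : ℝ) ^ β * (B₀ * R * S)) * M := by nlinarith
  · have hfarlen : (1 / 4 : ℝ) * ((L : ℝ) ^ j * x.i.η) ≤ x.i.η * len (p.2 - p.1) :=
      le_trans (mul_le_mul_of_nonneg_left (scale_mono hL hη.le hju) (by norm_num)) (quarter_scale_le_len hη.le hlen hxblk hcore)
    have hfar := weight_mul_hquot_le_of_far (len := len) hL U hβ0 (covDerivFwd x.i.η U.1 ν (fun z => ops.Gop U.1 (extZd P f) z μ)) hp j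
      (by norm_num : (0 : ℝ) < 1 / 4) hfarlen
    have hend : ∀ (z : Site d) (hzΩ : z ∈ x.i.Ω j),
        weight L x.i.η (-(2 : ℝ)) j * ‖covDerivFwd x.i.η U.1 ν (fun w => ops.Gop U.1 (extZd P f) w μ) z‖ ≤ B₀ * R * S * M := by
      intro z hzΩ
      have hz : P (z, μ) := hPΩ j hj z μ hzΩ
      have hjz : j ≤ (π ⟨(z, μ), hz⟩).1.1 := hlev ⟨(z, μ), hz⟩ j hj hzΩ
      have hg0 := weight_mul_norm_gradGop_le_of_ineq342' (len := len) hB₀ h342' hlin π hπ' hR hω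
        (fun u => pow_nonneg (B8ScaledSupNorm.scale_pos hL hη u.1.1).le 2) hex1 hS ν f hM hMf ⟨(z, μ), hz⟩
      have hw2 : weight L x.i.η (-(2 : ℝ)) j ≤ ((L : ℝ) ^ (π ⟨(z, μ), hz⟩).1.1 * x.i.η) ^ 2 := weight_two_le hL hη hjz
      exact (mul_le_mul_of_nonneg_right hw2 (norm_nonneg _)).trans hg0
    have he1 := hend p.1 hxΩ
    have he2 := hend p.2 hx'Ω
    have h4 : ((1 / 4 : ℝ)) ^ (-β) = (4 : ℝ) ^ β := by
      rw [Real.rpow_neg (by norm_num), one_div, Real.inv_rpow (by norm_num), inv_inv]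
    rw [h4] at hfar
    calc weight L x.i.η (-(2 + β)) j * hquot x.i.η β len U.1 (covDerivFwd x.i.η U.1 ν (fun z => ops.Gop U.1 (extZd P f) z μ)) p
        ≤ (4 : ℝ) ^ β * (weight L x.i.η (-(2 : ℝ)) j * ‖covDerivFwd x.i.η U.1 ν (fun z => ops.Gop U.1 (extZd P f) z μ) p.1‖ +
            weight L x.i.η (-(2 : ℝ)) j * ‖covDerivFwd x.i.η U.1 ν (fun z => ops.Gop U.1 (extZd P f) z μ) p.2‖) := hfar
      _ ≤ (4 : ℝ) ^ β * (B₀ * R * S * M + B₀ * R * S * M) := mul_le_mul_of_nonneg_left (add_le_add he1 he2) h4β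
      _ = 2 * (4 : ℝ) ^ β * (B₀ * R * S) * M := by ring
      _ ≤ (max 0 (Bβ β) * (((4 : ℝ) ^ β + 1) * R) * S + 2 * (4 : ℝ) ^ β * (B₀ * R * S)) * M := by nlinarith

/-- ★★ **the msup form in the binder owner's constant shape at Ξ** — from ONE exchange letter `hex3` and one row letter `hS`:
`msup … ≤ max ((4^β+1)·R·S) (2·4^β·R·S) · (B₀ + max 0 (Bβ β)) · M`. [cite: Balaban1985RegularSpaces, (1.36) p.82, (1.59) p.86, Prop. 3 p.87; Balaban1985BackgroundPropagators, Thm 3.3 p.399, (3.42)–(3.43) pp.397–398; Balaban1984PropagatorsII, Lemma 2.1 p.234] -/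
theorem holderBoth_msup_le_CHXi {x : MemberZd d L} [Fintype (BSite L x)] (hL : 1 ≤ L) {ops : OpsZd d 𝔸} {U : CfgZd d 𝔸}
    {B₀ δ₀ β : ℝ} {Bβ Bε : ℝ → ℝ} {Bεβ : ℝ → ℝ → ℝ} (hB₀ : 0 ≤ B₀)
    (h342 : B9.Ineq342_346_347 (GAZdXiOfOps 𝔸 L len x ops) B₀ δ₀ U) (h345 : B9.Ineq343_345 (GAZdXiOfOps 𝔸 L len x ops) Bβ Bε Bεβ δ₀ U)
    (hβ0 : 0 ≤ β) (hβ1 : β < 1) (hlen1 : ∀ v : Site d, 0 < len v → 1 ≤ len v)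
    (hlen : ∀ z z' : Site d, (linfDist z z' : ℝ) ≤ len (z' - z))
    (hlin : ∀ (c : ℝ) (A B : Site d → Fin d → 𝔸), ops.Gop U.1 (c • A + B) = c • ops.Gop U.1 A + ops.Gop U.1 B)
    {P : Site d × Fin d → Prop} (π : {b : Site d × Fin d // P b} → BSite L x)
    (hπ' : ∀ b, BondTouches (blockZd L (π b).1.1 (π b).1.2) b.1.1 b.1.2)
    (hπbase : ∀ (b : {b : Site d × Fin d // P b}) (j : ℕ), j ≤ x.m → b.1.1 ∈ x.i.Ω j → b.1.1 ∈ blockZd L (π b).1.1 (π b).1.2)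
    (hPΩ : ∀ j, j ≤ x.m → ∀ (z : Site d) (μ : Fin d), z ∈ x.i.Ω j → P (z, μ))
    (hlev : ∀ (b : {b : Site d × Fin d // P b}) (j : ℕ), j ≤ x.m → b.1.1 ∈ x.i.Ω j → j ≤ (π b).1.1)
    {κ₂ R S : ℝ} (hR : 0 ≤ R) {ω : BSite L x → ℝ} (hω : ∀ v, 0 < ω v)
    (hex3 : ∀ u v : BSite L x, ((L : ℝ) ^ u.1.1 * x.i.η) ^ 3 ≤ R * Real.exp (κ₂ * distZd L x u v) * ω v)
    (hS : ∀ u : BSite L x, ∑ v, Real.exp (-((δ₀ - κ₂) * distZd L x u v)) ≤ S)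
    (hS0 : 0 ≤ S) (f : {b : Site d × Fin d // P b} → 𝔸) {M : ℝ} (hM : 0 ≤ M) (hMf : ∀ y, ω (π y) * ‖f y‖ ≤ M) :
    msup L x.m x.i.η (-(2 + β))
        (fun j (q : Fin d × Fin d × (Site d × Site d)) => q.2.2 ∈ AdmPair x.i.η len ∧ q.2.2.1 ∈ x.i.Ω j ∧ q.2.2.2 ∈ x.i.Ω j)
        (fun q => hquot x.i.η β len U.1 (covDerivFwd x.i.η U.1 q.1 (fun z => ops.Gop U.1 (extZd P f) z q.2.1)) q.2.2) ≤
      max (((4 : ℝ) ^ β + 1) * R * S) (2 * (4 : ℝ) ^ β * R * S) * (B₀ + max 0 (Bβ β)) * M := by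
  have hη : 0 < x.i.η := x.i.hη
  have h4β : 0 ≤ (4 : ℝ) ^ β := Real.rpow_nonneg (by norm_num) β
  have hC : 0 ≤ max (((4 : ℝ) ^ β + 1) * R * S) (2 * (4 : ℝ) ^ β * R * S) * (B₀ + max 0 (Bβ β)) * M := by
    have : 0 ≤ max (((4 : ℝ) ^ β + 1) * R * S) (2 * (4 : ℝ) ^ β * R * S) := le_max_of_le_left (by positivity)
    positivity
  refine B8ScaledSupNorm.msup_le hC fun j hj q hq => ?_
  obtain ⟨hp, hxΩ, hx'Ω⟩ := hq
  rw [Real.norm_of_nonneg (hquot_nonneg hη.le β U.1 _ hp)]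
  have h := weight_mul_hquot_gradGop_le_bothXi hL hB₀ h342 h345 hβ0 hβ1 hlen1 hlen hlin π hπ' hπbase hPΩ hlev hR hω hex3 hS q.1 f hM hMf hj
    q.2.1 hp hxΩ hx'Ω
  refine h.trans ?_
  have ha : 0 ≤ max 0 (Bβ β) := le_max_left _ _
  have h1 : max 0 (Bβ β) * (((4 : ℝ) ^ β + 1) * R) * S ≤ max (((4 : ℝ) ^ β + 1) * R * S) (2 * (4 : ℝ) ^ β * R * S) * max 0 (Bβ β) := by
    calc max 0 (Bβ β) * (((4 : ℝ) ^ β + 1) * R) * S = (((4 : ℝ) ^ β + 1) * R * S) * max 0 (Bβ β) := by ring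
      _ ≤ max (((4 : ℝ) ^ β + 1) * R * S) (2 * (4 : ℝ) ^ β * R * S) * max 0 (Bβ β) := mul_le_mul_of_nonneg_right (le_max_left _ _) ha
  have h2 : 2 * (4 : ℝ) ^ β * (B₀ * R * S) ≤ max (((4 : ℝ) ^ β + 1) * R * S) (2 * (4 : ℝ) ^ β * R * S) * B₀ := by
    calc 2 * (4 : ℝ) ^ β * (B₀ * R * S) = (2 * (4 : ℝ) ^ β * R * S) * B₀ := by ring
      _ ≤ max (((4 : ℝ) ^ β + 1) * R * S) (2 * (4 : ℝ) ^ β * R * S) * B₀ := mul_le_mul_of_nonneg_right (le_max_right _ _) hB₀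
  have h3 : max 0 (Bβ β) * (((4 : ℝ) ^ β + 1) * R) * S + 2 * (4 : ℝ) ^ β * (B₀ * R * S) ≤
      max (((4 : ℝ) ^ β + 1) * R * S) (2 * (4 : ℝ) ^ β * R * S) * (B₀ + max 0 (Bβ β)) := by
    nlinarith
  exact mul_le_mul_of_nonneg_right h3 hM

end Both

/-! ## §3 The discharge of `HolderAtδ2` at the Ξ frame: a core over abstract Lemma-2.1 letters, the finite-member constant, the member-UNIFORM constant -/

section Discharge

variable {𝔸 : Type} [CStarAlgebra 𝔸] [Nontrivial 𝔸] {L : ℕ}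

-- budget line: the proof instantiates two long summation theorems and builds the block assignment by choice (g2's §4 shape)
set_option maxHeartbeats 400000 in
/-- ★★ **THE CORE: THE WEIGHTED HÖLDER SUPREMUM OF `∇_{U₀}G(U₀)J` IS BOUNDED BY `max((4^β+1)RS, 2·4^β RS)·(B₀ + max 0 (Bβ β))·|J|₍₋₃₎` ON A FINITE MEMBER, FOR ANY PAIR OF
LEMMA-2.1 LETTERS** — `hex3 : (L^{j_u}η)³ ≤ R·e^{κ₂d(u,v)}·(L^{j_v}η)³` (cube exchange, (2.60)-shape) and `hS : Σ_v e^{−(δ₀−κ₂)d(u,v)} ≤ S` (row sum, (2.61)-shape) — at the Ξ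
readings (3.42)+(3.43) of an ℝ-linear `Ω₀`-restricted `G(U₀)`, under the block laws (T) «level-j block ⊆ Ω_j», (G1′) «sites of Ω_j lie in blocks», (G2′) «a level-j_y block
meets Ω_j only for j ≤ j_y»; `1 ≤ L`, `0 ≤ β < 1`, `len` with `1 ≤ len` and `|·|_∞ ≤ len`.  The proof is g2's: source class = bonds touching `Ω₀`, assigned to a block they
TOUCH, `J ↦ 𝟙_{Ω₀-bonds}J = extZd`, `holderBoth_msup_le_CHXi`, `M := |J|₍₋₃₎`, and `0 ≤ B₀` from the bump (or everything vanishes).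
[cite: Balaban1985RegularSpaces, (1.36) p.82, (1.59) p.86, (1.62) + Prop. 3 p.87; Balaban1985BackgroundPropagators, Thm 3.3 p.399, (3.42)–(3.43) pp.397–398; Balaban1984PropagatorsII, Lemma 2.1 (2.60)–(2.61) p.234] -/
theorem msup_holder_le_of_letters (hL : 1 ≤ L) {len : Site d → ℝ} (hlen1 : ∀ v : Site d, 0 < len v → 1 ≤ len v)
    (hlen : ∀ z z' : Site d, (linfDist z z' : ℝ) ≤ len (z' - z)) {β : ℝ} (hβ0 : 0 ≤ β) (hβ1 : β < 1)
    (ops : ℝ → ZdIdx d L → ℕ → OpsZd d 𝔸) (M : ℝ) (i : ZdIdx d L) (m : ℕ)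
    [Fintype (BSite L (memZd M i m))] (hΩfin : (i.Ω 0).Finite)
    (hT : ∀ y : BSite L (memZd M i m), blockZd L y.1.1 y.1.2 ⊆ i.Ω y.1.1)
    (hcover : ∀ j, j ≤ m → ∀ z : Site d, z ∈ i.Ω j → ∃ y : BSite L (memZd M i m), z ∈ blockZd L y.1.1 y.1.2)
    (hlevel : ∀ (y : BSite L (memZd M i m)) (z : Site d), z ∈ blockZd L y.1.1 y.1.2 → ∀ j, j ≤ m → z ∈ i.Ω j → j ≤ y.1.1)
    (hlin : ∀ (U₀ : Site d → Fin d → 𝔸ˣ) (c : ℝ) (A B : Site d → Fin d → 𝔸),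
      (ops M i m).Gop U₀ (c • A + B) = c • (ops M i m).Gop U₀ A + (ops M i m).Gop U₀ B)
    (hrestrict : ∀ (U₀ : Site d → Fin d → 𝔸ˣ) (J : Site d → Fin d → 𝔸), (ops M i m).Gop U₀ J = (ops M i m).Gop U₀ (restrictDom (i.Ω 0) J))
    {Bβ Bε : ℝ → ℝ} {Bεβ : ℝ → ℝ → ℝ} {δ₀ B₀ : ℝ} {U₀ : Site d → Fin d → 𝔸ˣ} (hU₀ : ∀ x κ, U₀ x κ ∈ unitaryUnits 𝔸)
    (h342 : B9.Ineq342_346_347 (GAZdXiOfOps 𝔸 L len (memZd M i m) (ops M i m)) B₀ δ₀ (⟨U₀, hU₀⟩ : CfgZd d 𝔸))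
    (h345 : B9.Ineq343_345 (GAZdXiOfOps 𝔸 L len (memZd M i m) (ops M i m)) Bβ Bε Bεβ δ₀ (⟨U₀, hU₀⟩ : CfgZd d 𝔸))
    {κ₂ R S : ℝ} (hR : 0 ≤ R)
    (hex3 : ∀ u v : BSite L (memZd M i m), ((L : ℝ) ^ u.1.1 * i.η) ^ 3 ≤ R * Real.exp (κ₂ * distZd L (memZd M i m) u v) * ((L : ℝ) ^ v.1.1 * i.η) ^ 3)
    (hS : ∀ u : BSite L (memZd M i m), ∑ v, Real.exp (-((δ₀ - κ₂) * distZd L (memZd M i m) u v)) ≤ S) (hS0 : 0 ≤ S)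
    (J : Site d → Fin d → 𝔸) :
    msup L m i.η (-(2 + β))
        (fun j (q : Fin d × Fin d × (Site d × Site d)) => q.2.2 ∈ AdmPair i.η len ∧ q.2.2.1 ∈ i.Ω j ∧ q.2.2.2 ∈ i.Ω j)
        (fun q => hquot i.η β len U₀ (covDerivFwd i.η U₀ q.1 (fun z => (ops M i m).Gop U₀ J z q.2.1)) q.2.2) ≤
      max (((4 : ℝ) ^ β + 1) * R * S) (2 * (4 : ℝ) ^ β * R * S) * (B₀ + max 0 (Bβ β)) * bondNorm L m i.η (-(3 : ℝ)) i.Ω J := by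
  classical
  have hη : 0 < i.η := i.hη
  have h342' := ineq342Zd_of_ineq342Xi (𝔸 := 𝔸) (L := L) (len := len) h342
  set U : CfgZd d 𝔸 := ⟨U₀, hU₀⟩ with hU
  -- the source class: bonds touching `Ω₀`; block assignment by choice (base's block if the base is a site of `Ω₀`, else the tip's)
  let P : Site d × Fin d → Prop := fun b => BondTouches (i.Ω 0) b.1 b.2
  have hπex : ∀ b : {b : Site d × Fin d // P b}, ∃ y : BSite L (memZd M i m), BondTouches (blockZd L y.1.1 y.1.2) b.1.1 b.1.2 ∧
      ((∃ y' : BSite L (memZd M i m), b.1.1 ∈ blockZd L y'.1.1 y'.1.2) → b.1.1 ∈ blockZd L y.1.1 y.1.2) := by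
    intro b
    by_cases hb : ∃ y' : BSite L (memZd M i m), b.1.1 ∈ blockZd L y'.1.1 y'.1.2
    · obtain ⟨y', hy'⟩ := hb
      exact ⟨y', Or.inl hy', fun _ => hy'⟩
    · rcases b.2 with h0 | h1
      · exact absurd (hcover 0 (Nat.zero_le _) _ h0) hb
      · obtain ⟨y, hy⟩ := hcover 0 (Nat.zero_le _) _ h1
        exact ⟨y, Or.inr hy, fun h => absurd h hb⟩
  choose π hπ' hπb using hπex
  have hπbase : ∀ (b : {b : Site d × Fin d // P b}) (j : ℕ), j ≤ m → b.1.1 ∈ i.Ω j → b.1.1 ∈ blockZd L (π b).1.1 (π b).1.2 :=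
    fun b j hj hz => hπb b (hcover j hj _ hz)
  have hPΩ : ∀ j, j ≤ m → ∀ (z : Site d) (μ : Fin d), z ∈ i.Ω j → P (z, μ) :=
    fun j _ z μ hz => Or.inl (Omega_antitone i (Nat.zero_le j) hz)
  have hlev : ∀ (b : {b : Site d × Fin d // P b}) (j : ℕ), j ≤ m → b.1.1 ∈ i.Ω j → j ≤ (π b).1.1 :=
    fun b j hj hz => hlevel (π b) b.1.1 (hπbase b j hj hz) j hj hz
  -- the source `f := J|P` and `G(U₀)J = G(U₀)f̃`
  let f : {b : Site d × Fin d // P b} → 𝔸 := fun b => J b.1.1 b.1.2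
  have hext : restrictDom (i.Ω 0) J = extZd P f := restrictDom_eq_extZd (i.Ω 0) J
  have hGJ : ∀ (z : Site d) (μ : Fin d), (ops M i m).Gop U₀ J z μ = (ops M i m).Gop U.1 (extZd P f) z μ := by
    intro z μ; rw [hrestrict U₀ J, hext]
  -- weights
  let ω : BSite L (memZd M i m) → ℝ := fun v => ((L : ℝ) ^ v.1.1 * i.η) ^ 3
  have hω : ∀ v, 0 < ω v := fun v => pow_pos (B8ScaledSupNorm.scale_pos hL hη v.1.1) 3
  -- `M := |J|₍₋₃₎` bounds the weighted source values
  have hBdd := bdd_neg_three_of_finite (L := L) (m := m) i hΩfin J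
  have hM0 : 0 ≤ bondNorm L m i.η (-(3 : ℝ)) i.Ω J := B8ScaledSupNorm.msup_nonneg L m hη.le _ _ _
  have hMf : ∀ y : {b : Site d × Fin d // P b}, ω (π y) * ‖f y‖ ≤ bondNorm L m i.η (-(3 : ℝ)) i.Ω J := by
    intro y
    have e3 : (-(3 : ℝ)) = -((3 : ℕ) : ℝ) := by norm_num
    have hw : weight L i.η (-(3 : ℝ)) (π y).1.1 = ((L : ℝ) ^ (π y).1.1 * i.η) ^ 3 := by rw [e3, B8ScaledSupNorm.weight_neg_natCast]
    have hcls : BondTouches (i.Ω (π y).1.1) y.1.1 y.1.2 :=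
      (hπ' y).imp (fun h => hT (π y) h) (fun h => hT (π y) h)
    have := weight_mul_norm_le_msup hBdd (π y).2.1 (i := (y.1.1, y.1.2)) hcls
    rw [hw] at this
    exact this
  -- `0 ≤ B₀`, or every class is empty
  by_cases hB₀ : 0 ≤ B₀
  · have h := holderBoth_msup_le_CHXi (len := len) hL hB₀ h342 h345 hβ0 hβ1 hlen1 hlen (hlin U₀) π hπ' hπbase hPΩ hlev hR hω hex3 hS hS0 f hM0 hMf
    have hrw : (fun q : Fin d × Fin d × (Site d × Site d) =>
        hquot i.η β len U₀ (covDerivFwd i.η U₀ q.1 (fun z => (ops M i m).Gop U₀ J z q.2.1)) q.2.2) =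
        (fun q : Fin d × Fin d × (Site d × Site d) =>
          hquot i.η β len U.1 (covDerivFwd i.η U.1 q.1 (fun z => (ops M i m).Gop U.1 (extZd P f) z q.2.1)) q.2.2) := by
      funext q
      have : (fun z => (ops M i m).Gop U₀ J z q.2.1) = (fun z => (ops M i m).Gop U.1 (extZd P f) z q.2.1) := funext fun z => hGJ z q.2.1
      rw [this]
    rw [hrw]
    exact h
  · -- `B₀ < 0`: no block can carry a bond of `Ω₀` (else the bump contradicts (3.42)), so both weighted suprema run over empty index sets
    have hnone : ∀ j, j ≤ m → ∀ (z : Site d) (μ : Fin d), ¬ BondTouches (i.Ω j) z μ := by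
      intro j hj z μ hb
      rcases hb with hz | hz
      · obtain ⟨y, hy⟩ := hcover j hj z hz
        exact hB₀ (B0_nonneg_of_ineq342_zd (len := len) hL h342' y hy μ)
      · obtain ⟨y, hy⟩ := hcover j hj (z + e μ) hz
        exact hB₀ (B0_nonneg_of_ineq342_zd (len := len) hL h342' y hy μ)
    have hL0 : msup L m i.η (-(2 + β))
        (fun j (q : Fin d × Fin d × (Site d × Site d)) => q.2.2 ∈ AdmPair i.η len ∧ q.2.2.1 ∈ i.Ω j ∧ q.2.2.2 ∈ i.Ω j)
        (fun q => hquot i.η β len U₀ (covDerivFwd i.η U₀ q.1 (fun z => (ops M i m).Gop U₀ J z q.2.1)) q.2.2) = 0 := by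
      haveI : IsEmpty (B8ScaledSupNorm.Idx m (fun j (q : Fin d × Fin d × (Site d × Site d)) =>
          q.2.2 ∈ AdmPair i.η len ∧ q.2.2.1 ∈ i.Ω j ∧ q.2.2.2 ∈ i.Ω j)) :=
        ⟨fun p => hnone p.1.1 p.2.1 p.1.2.2.2.1 p.1.2.1 (Or.inl p.2.2.2.1)⟩
      exact Real.iSup_of_isEmpty _
    have hR0 : bondNorm L m i.η (-(3 : ℝ)) i.Ω J = 0 := by
      haveI : IsEmpty (B8ScaledSupNorm.Idx m (fun j (b : Site d × Fin d) => BondTouches (i.Ω j) b.1 b.2)) :=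
        ⟨fun p => hnone p.1.1 p.2.1 p.1.2.1 p.1.2.2 p.2.2⟩
      exact Real.iSup_of_isEmpty _
    rw [hL0, hR0, mul_zero]

/-- ★★★ **`HolderAtδ2` AT THE Ξ FRAME IS A THEOREM ON EVERY FINITE MEMBER, WITH AN `η`-FREE CONSTANT** — dag-n06-b's binder (p598001) at `geoZdXi ∕ bgZd ∕ GAZdXiFamOfOps ∕
memZd ∕ ιCfgZd`, EXACTLY g2's `holderAtδ2_zd_of_finite` hypotheses, with `CH := fun _ => max ((4^β+1)·E₃·|𝔅|) (2·4^β·E₃·|𝔅|)`, `E₃ := (max_u (L^{j_u}η)³)·(max_v ((L^{j_v}η)³)⁻¹)`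
(`= L^{3(j_max−j_min)} ≤ L^{3m}`: the member's cube-exchange letter at `κ₂ := 0`, `exchangeLetter_of_fintype`; row letter `|𝔅|`, `rowLetter_of_fintype`).  No `η^{−β}` any more.
[cite: Balaban1985RegularSpaces, (1.36) p.82, (1.59) p.86, (1.62) + Prop. 3 p.87; Balaban1985BackgroundPropagators, Thm 3.3 p.399, (3.42)–(3.43) pp.397–398 («ξ = L^{−j}»); Balaban1984PropagatorsII, Lemma 2.1 p.234 (member constants)] -/
theorem holderAtδ2_zdXi_of_finite (hL : 1 ≤ L) {len : Site d → ℝ} (hlen1 : ∀ v : Site d, 0 < len v → 1 ≤ len v)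
    (hlen : ∀ z z' : Site d, (linfDist z z' : ℝ) ≤ len (z' - z)) {β : ℝ} (hβ0 : 0 ≤ β) (hβ1 : β < 1)
    (ops : ℝ → ZdIdx d L → ℕ → OpsZd d 𝔸) (M : ℝ) (i : ZdIdx d L) (m : ℕ)
    [Fintype (BSite L (memZd M i m))] [Nonempty (BSite L (memZd M i m))] (hΩfin : (i.Ω 0).Finite)
    (hT : ∀ y : BSite L (memZd M i m), blockZd L y.1.1 y.1.2 ⊆ i.Ω y.1.1)
    (hcover : ∀ j, j ≤ m → ∀ z : Site d, z ∈ i.Ω j → ∃ y : BSite L (memZd M i m), z ∈ blockZd L y.1.1 y.1.2)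
    (hlevel : ∀ (y : BSite L (memZd M i m)) (z : Site d), z ∈ blockZd L y.1.1 y.1.2 → ∀ j, j ≤ m → z ∈ i.Ω j → j ≤ y.1.1)
    (hlin : ∀ (U₀ : Site d → Fin d → 𝔸ˣ) (c : ℝ) (A B : Site d → Fin d → 𝔸),
      (ops M i m).Gop U₀ (c • A + B) = c • (ops M i m).Gop U₀ A + (ops M i m).Gop U₀ B)
    (hrestrict : ∀ (U₀ : Site d → Fin d → 𝔸ˣ) (J : Site d → Fin d → 𝔸), (ops M i m).Gop U₀ J = (ops M i m).Gop U₀ (restrictDom (i.Ω 0) J)) :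
    HolderAtδ2 (geoZdXi 𝔸 L len) (bgZd 𝔸 L) (GAZdXiFamOfOps 𝔸 L len ops) L memZd (ιCfgZd 𝔸 L) ops β len
      (fun _ => max
        (((4 : ℝ) ^ β + 1) *
          ((Finset.univ.sup' Finset.univ_nonempty fun u : BSite L (memZd M i m) => 1 * ((L : ℝ) ^ u.1.1 * i.η) ^ 3) *
            (Finset.univ.sup' Finset.univ_nonempty fun v : BSite L (memZd M i m) => (((L : ℝ) ^ v.1.1 * i.η) ^ 3)⁻¹)) *
          (Fintype.card (BSite L (memZd M i m)) : ℝ))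
        (2 * (4 : ℝ) ^ β *
          ((Finset.univ.sup' Finset.univ_nonempty fun u : BSite L (memZd M i m) => 1 * ((L : ℝ) ^ u.1.1 * i.η) ^ 3) *
            (Finset.univ.sup' Finset.univ_nonempty fun v : BSite L (memZd M i m) => (((L : ℝ) ^ v.1.1 * i.η) ^ 3)⁻¹)) *
          (Fintype.card (BSite L (memZd M i m)) : ℝ))) M i m := by
  intro Bβ Bε Bεβ δ₀ B₀ U₀ hU₀ hδ₀ h342 h345 J
  have hη : 0 < i.η := i.hη
  change B9.Ineq342_346_347 (GAZdXiOfOps 𝔸 L len (memZd M i m) (ops M i m)) B₀ δ₀ (⟨U₀, hU₀⟩ : CfgZd d 𝔸) at h342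
  change B9.Ineq343_345 (GAZdXiOfOps 𝔸 L len (memZd M i m) (ops M i m)) Bβ Bε Bεβ δ₀ (⟨U₀, hU₀⟩ : CfgZd d 𝔸) at h345
  -- the member's letters at `κ₂ := 0`: ONE cube-exchange letter for `(Lʲη)³`, row letter `|𝔅|`
  have hω : ∀ v : BSite L (memZd M i m), 0 < ((L : ℝ) ^ v.1.1 * i.η) ^ 3 := fun v => pow_pos (B8ScaledSupNorm.scale_pos hL hη v.1.1) 3
  have ha3 : ∀ u : BSite L (memZd M i m), 0 ≤ (1 : ℝ) * ((L : ℝ) ^ u.1.1 * i.η) ^ 3 := fun u =>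
    mul_nonneg zero_le_one (pow_nonneg (B8ScaledSupNorm.scale_pos hL hη u.1.1).le 3)
  have hex3 : ∀ u v : BSite L (memZd M i m), ((L : ℝ) ^ u.1.1 * i.η) ^ 3 ≤
      ((Finset.univ.sup' Finset.univ_nonempty fun u : BSite L (memZd M i m) => 1 * ((L : ℝ) ^ u.1.1 * i.η) ^ 3) *
        (Finset.univ.sup' Finset.univ_nonempty fun v : BSite L (memZd M i m) => (((L : ℝ) ^ v.1.1 * i.η) ^ 3)⁻¹)) *
          Real.exp (0 * distZd L (memZd M i m) u v) * ((L : ℝ) ^ v.1.1 * i.η) ^ 3 := by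
    intro u v
    have h := exchangeLetter_of_fintype (ω := fun v : BSite L (memZd M i m) => ((L : ℝ) ^ v.1.1 * i.η) ^ 3) (ω' := fun _ => (1 : ℝ))
      (a := fun u : BSite L (memZd M i m) => ((L : ℝ) ^ u.1.1 * i.η) ^ 3) hω ha3 u v
    rwa [one_mul] at h
  have h := msup_holder_le_of_letters (len := len) hL hlen1 hlen hβ0 hβ1 ops M i m hΩfin hT hcover hlevel hlin hrestrict hU₀ h342 h345
    (κ₂ := 0) (exchangeConst_nonneg hω ha3) hex3 (fun u => by rw [sub_zero]; exact rowLetter_of_fintype hδ₀.le u) (Nat.cast_nonneg _) J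
  refine h.trans (le_of_eq ?_)
  ring

open Classical in
/-- ★★★ **`HolderAtδ2` AT THE Ξ FRAME WITH PRINT'S MEMBER-UNIFORM CONSTANT** ([4] Lemma 2.1 (2.60)∕(2.61) in print's regime): on a finite member whose block graph is connected
(e.g. `Ω₀` a box — `B9GraphZdConnected.preconnected_of_box` — or `ℤᵈ`), with the (2.2) separation `Sep22Zd R`, laws (T)(G1′)(G2′), `N₀ ≤ R⌈M⌉`, `3 log L ≤ κ₂R⌈M⌉`, `0 ≤ κ₂`, the binder
holds with `CH δ₀ := max ((4^β+1)·L³·K) (2·4^β·L³·K)`, `K = K261 N₀ d L 1 (δ₀ − κ₂)` — a function of `(d, L, β, N₀, κ₂, δ₀)` ONLY — for every `δ₀` in the summable regime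
`e^{−(δ₀−κ₂)}L^{2d∕N₀} < 1`, and with the finite-member constant of `holderAtδ2_zdXi_of_finite` otherwise (the binder quantifies over all `δ₀ > 0`).  Exchange letter =
g2's `cube_exchange_of_connected`, row letter = g2's `rowLetter261_hS`. [cite: Balaban1984PropagatorsII, Lemma 2.1 (2.60)–(2.61) p.234, (2.59) p.233; Balaban1985BackgroundPropagators, (3.43) p.398 («ξ = L^{−j}»), p.398 l.17–20, Thm 3.3 p.399; Balaban1985RegularSpaces, (1.36) p.82, (1.59) p.86, Prop. 3 p.87] -/
theorem holderAtδ2_zdXi_uniform (hL : 1 ≤ L) {len : Site d → ℝ} (hlen1 : ∀ v : Site d, 0 < len v → 1 ≤ len v)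
    (hlen : ∀ z z' : Site d, (linfDist z z' : ℝ) ≤ len (z' - z)) {β : ℝ} (hβ0 : 0 ≤ β) (hβ1 : β < 1)
    (ops : ℝ → ZdIdx d L → ℕ → OpsZd d 𝔸) (M : ℝ) (i : ZdIdx d L) (m : ℕ)
    [Fintype (BSite L (memZd M i m))] [Nonempty (BSite L (memZd M i m))] (hΩfin : (i.Ω 0).Finite)
    (hT : ∀ y : BSite L (memZd M i m), blockZd L y.1.1 y.1.2 ⊆ i.Ω y.1.1)
    (hcover : ∀ j, j ≤ m → ∀ z : Site d, z ∈ i.Ω j → ∃ y : BSite L (memZd M i m), z ∈ blockZd L y.1.1 y.1.2)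
    (hlevel : ∀ (y : BSite L (memZd M i m)) (z : Site d), z ∈ blockZd L y.1.1 y.1.2 → ∀ j, j ≤ m → z ∈ i.Ω j → j ≤ y.1.1)
    {R : ℕ} (hsep : Sep22Zd R (memZd M i m)) (hconn : ∀ u v : BSite L (memZd M i m), (graphZd L (memZd M i m)).Reachable u v)
    {κ₂ : ℝ} (hκ₂ : 0 ≤ κ₂) (hrate : 3 * Real.log L ≤ κ₂ * ((R : ℝ) * ⌈M⌉₊))
    {N₀ : ℕ} (hN₀ : 0 < N₀) (hMN : N₀ ≤ R * ⌈M⌉₊)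
    (hlin : ∀ (U₀ : Site d → Fin d → 𝔸ˣ) (c : ℝ) (A B : Site d → Fin d → 𝔸),
      (ops M i m).Gop U₀ (c • A + B) = c • (ops M i m).Gop U₀ A + (ops M i m).Gop U₀ B)
    (hrestrict : ∀ (U₀ : Site d → Fin d → 𝔸ˣ) (J : Site d → Fin d → 𝔸), (ops M i m).Gop U₀ J = (ops M i m).Gop U₀ (restrictDom (i.Ω 0) J)) :
    HolderAtδ2 (geoZdXi 𝔸 L len) (bgZd 𝔸 L) (GAZdXiFamOfOps 𝔸 L len ops) L memZd (ιCfgZd 𝔸 L) ops β len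
      (fun δ₀ => if Real.exp (-(δ₀ - κ₂)) * (L : ℝ) ^ ((2 * d : ℝ) / N₀) < 1 then
          max (((4 : ℝ) ^ β + 1) * (L : ℝ) ^ 3 * K261 N₀ d L 1 (δ₀ - κ₂)) (2 * (4 : ℝ) ^ β * (L : ℝ) ^ 3 * K261 N₀ d L 1 (δ₀ - κ₂))
        else max
          (((4 : ℝ) ^ β + 1) *
            ((Finset.univ.sup' Finset.univ_nonempty fun u : BSite L (memZd M i m) => 1 * ((L : ℝ) ^ u.1.1 * i.η) ^ 3) *
              (Finset.univ.sup' Finset.univ_nonempty fun v : BSite L (memZd M i m) => (((L : ℝ) ^ v.1.1 * i.η) ^ 3)⁻¹)) *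
            (Fintype.card (BSite L (memZd M i m)) : ℝ))
          (2 * (4 : ℝ) ^ β *
            ((Finset.univ.sup' Finset.univ_nonempty fun u : BSite L (memZd M i m) => 1 * ((L : ℝ) ^ u.1.1 * i.η) ^ 3) *
              (Finset.univ.sup' Finset.univ_nonempty fun v : BSite L (memZd M i m) => (((L : ℝ) ^ v.1.1 * i.η) ^ 3)⁻¹)) *
            (Fintype.card (BSite L (memZd M i m)) : ℝ))) M i m := by
  intro Bβ Bε Bεβ δ₀ B₀ U₀ hU₀ hδ₀ h342 h345 J
  by_cases hθ : Real.exp (-(δ₀ - κ₂)) * (L : ℝ) ^ ((2 * d : ℝ) / N₀) < 1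
  · dsimp only
    rw [if_pos hθ]
    have hη : 0 < i.η := i.hη
    change B9.Ineq342_346_347 (GAZdXiOfOps 𝔸 L len (memZd M i m) (ops M i m)) B₀ δ₀ (⟨U₀, hU₀⟩ : CfgZd d 𝔸) at h342
    change B9.Ineq343_345 (GAZdXiOfOps 𝔸 L len (memZd M i m) (ops M i m)) Bβ Bε Bεβ δ₀ (⟨U₀, hU₀⟩ : CfgZd d 𝔸) at h345
    have hex3 : ∀ u v : BSite L (memZd M i m), ((L : ℝ) ^ u.1.1 * i.η) ^ 3 ≤
        (L : ℝ) ^ 3 * Real.exp (κ₂ * distZd L (memZd M i m) u v) * ((L : ℝ) ^ v.1.1 * i.η) ^ 3 := by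
      intro u v
      have h := cube_exchange_of_connected hT hlevel hL hsep hconn hκ₂ hrate u v
      rwa [← pow_succ] at h
    have h := msup_holder_le_of_letters (len := len) hL hlen1 hlen hβ0 hβ1 ops M i m hΩfin hT hcover hlevel hlin hrestrict hU₀ h342 h345
      (κ₂ := κ₂) (by positivity) hex3 (rowLetter261_hS hT hlevel hL hsep hconn hN₀ hMN hθ)
      (K261_nonneg (by positivity) zero_le_one) J
    refine h.trans (le_of_eq ?_)
    ring
  · dsimp only
    rw [if_neg hθ]
    exact holderAtδ2_zdXi_of_finite hL hlen1 hlen hβ0 hβ1 ops M i m hΩfin hT hcover hlevel hlin hrestrict Bβ Bε Bεβ δ₀ B₀ U₀ hU₀ hδ₀ h342 h345 J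

end Discharge

end Literature.MathematicalPhysics.QuantumFieldTheory.Balaban1983to89.B9Eq343HolderXiZdFinite

end
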